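import Literature.MathematicalPhysics.QuantumFieldTheory.Balaban1983to89.B9Eq386Neumann
import Literature.MathematicalPhysics.QuantumFieldTheory.King1986.CovarianceSplitting
import Mathlib.Topology.UniformSpace.Matrix
import HarnessLib

/-!
# `UnitScaleTiltFluctuationComparisonRegPrTwoCutoffNeumannTransport` — THE TWO-CUT-OFF (TWO-LATTICE) BOOKKEEPING OF [B9] (3.84)–(3.86):
# a bounded additive multiplicative transport commutes with the Neumann-series propagator `G(U′U) = G(U)(I − V(A)G(U))⁻¹`, and that propagator is
# Lipschitz in the pair `(G(U), V(A)G(U))` — so the two-cut-off row of the CURVED propagator is the two-cut-off row of the FLAT one plus that of `V(A)G(U)`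
# (crux `FluctuationComparisonRegPrIntL`, stmt-QuantumFields-20520, STUB 3⁗χ(v4); cell `pub/ym-inputs`, INPUT-LIST I-11 row p10 «K-uniform two-cut-off propagator
# estimate behind `FlatKernelLegCauchyΦ`»; seat ym-inputs-p10 g3, count-neutral helper, def-free)

WHY.  The I-11 row p10 is the comparison of ONE operator family at two UV cut-offs: run `K`'s propagator `G^{(K)}_k(Ω; U₀)` on the `η_K`-lattice against run
`K+1`'s `G^{(K+1)}_{k+1}(Ω; U₀′)` on the finer `η_{K+1} = η_K∕L` lattice, read through a prolongation ∕ restriction pair `J : 𝓗_K → 𝓗_{K+1}`, `R : 𝓗_{K+1} → 𝓗_K`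
with `R ∘ J = id` (block-constant prolongation followed by the block average is the identity), i.e. `‖J G^{(K)} R − G^{(K+1)}‖` small at the rate `L^{−a·k}`.  Its FLAT
`U₀ = 1` template is [King1986] §4 (tree: `King1986.CompositionLaw.lemma43_aK`; height-free references ✓`TwoCutoffSymbolHeightFree.exists_heightFree_limit`,
✓`TwoCutoffOperatorHeightFree.exists_heightFree_operator`, ✓`TwoCutoffCovarianceHeightFree.exists_heightFree_covariance`).  [Balaban1985BackgroundPropagators] §3 passes
from the flat propagator to a small-field background by (3.84) `Δ_a(U′U) = (I − V(A)G(U))Δ_a(U)` and the Neumann series (3.86) `G(U′U) = G(U)(I − V(A)G(U))⁻¹ =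
Σ_n G(U)(V(A)G(U))ⁿ` on ONE lattice (tree: `Balaban1983to89.B9Eq386Neumann.gNew G V := G·∑'(VG)ⁿ`, generic normed ring).  What a two-cut-off comparison of the CURVED
propagators needs on top of that is pure bookkeeping, typed here once, abstractly:

* §1 (one complete normed ring) the resolvent identity `Σaⁿ − Σbⁿ = (Σaⁿ)(a − b)(Σbⁿ)` and **`norm_gNew_sub_gNew_le`**: `gNew` is LIPSCHITZ IN THE PAIR `(G, VG)` —
  `‖gNew G₁ V₁ − gNew G₂ V₂‖ ≤ σ₁‖G₁ − G₂‖ + σ₁σ₂‖G₂‖·‖V₁G₁ − V₂G₂‖`, `σᵢ = ‖1‖ − 1 + (1 − ‖VᵢGᵢ‖)⁻¹` (`= (1 − ‖VᵢGᵢ‖)⁻¹` when `‖1‖ = 1`).  The COMPOSITE `VG` is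
  the letter on purpose: a first-order `V(A)` at two lattice spacings has no limit in operator norm, the smoothing composite `V(A)G(U)` (print's (3.85) kernel) does.
* §2 (two rings) **`map_gNew`**: a CONTINUOUS ADDITIVE map `φ : A →+ B` that is MULTIPLICATIVE (`φ(xy) = φx·φy`; `φ 1 = 1` is never used — a conjugation
  `X ↦ J X R` is not unital) satisfies `φ(gNew G V) = gNew (φG) (φV)` whenever both geometric series converge (`HasSum.map` termwise on `φ(G(VG)ⁿ) = φG(φV·φG)ⁿ`).
* §3 **`norm_map_gNew_sub_gNew_le`** ∕ **`…_of_near`**: THE TWO-CUT-OFF ROW OF THE CURVED PROPAGATOR FROM THE FLAT ROW AND THE `VG` ROW —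
  `‖φ(gNew G₁ V₁) − gNew G₂ V₂‖ ≤ σ₁′‖φG₁ − G₂‖ + σ₁′σ₂‖G₂‖·‖φ(V₁G₁) − V₂G₂‖`, and with `‖V₂G₂‖ ≤ q`, `‖φ(V₁G₁) − V₂G₂‖ ≤ ε`, `q + ε < 1`, `‖1‖ ≤ 1`:
  `≤ ‖φG₁ − G₂‖∕(1 − (q+ε)) + ‖G₂‖·ε∕(1 − (q+ε))²` — smallness of the transported composite is DERIVED, not assumed.
* §4 the instance every lattice use has in mind: `φ X = J ∘L (X ∘L R)` on `(E₁ →L[𝕜] E₁) → (E₂ →L[𝕜] E₂)` with `R ∘L J = id` is additive, multiplicative, bounded by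
  `‖J‖‖R‖`; hence **`conj_gNew`** (`J (gNew G V) R = gNew (JGR) (JVR)`) and **`norm_conj_gNew_sub_gNew_le_of_near`**, the operator-level two-cut-off estimate by name.
* §5 the SUP NORM OF KERNELS (Mathlib's `ℓ^∞`-operator norm on matrices, `open scoped Matrix.Norms.Operator` — print's «small operator in supremum norm»): row sums ∕
  decaying kernels bound the norm, rectangular `R J = 1` conjugation, **`norm_matConj_gNew_sub_gNew_le_of_near`**; and KING'S BLOCK PAIR on the tori of `King1986/*`:
  `R = Q` (block mean `Torus.Qmat`), `J = N^d·Qᵀ` (block-constant prolongation), **`Qmat_mul_prolong`** `Q(N^dQᵀ) = 1`, the kernel dictionary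
  `((N^dQᵀ)XQ)(z,z′) = N^{−d}X(⌊z∕N⌋,⌊z′∕N⌋)`, `‖Q‖, ‖N^dQᵀ‖ ≤ 1` (the transport CONTRACTS), **`norm_blockConj_gNew_sub_gNew_le_of_near`**.

HONEST FRAMING.  Ring algebra and the geometric series ([folklore]; the `[cite]` tags LOCATE the printed sentence a lemma makes honest, they do not appeal to it).  In any
use the three inputs — the FLAT two-cut-off row `‖φG₁ − G₂‖`, the COMPOSITE row `‖φ(V₁G₁) − V₂G₂‖`, the smallness `‖VG‖ < 1` — are BINDERS: the flat row is [King1986] §4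
(proved in the tree at the symbol ∕ operator ∕ covariance layers), the composite row for [B9]'s `V(A)G(U)` at two cut-offs is UNPRINTED for non-abelian `d = 3` (INPUT-LIST
I-11, KILL-TEST E2 = NO) and is NOT asserted here; no carrier of `G_k(Ω; U₀)` exists in the tree (I-06, p01's layer 0).  Nothing of [Balaban1985BackgroundPropagators] ∕
[Balaban1985UV3] ∕ [King1986] is asserted; no stub, crux or (α)-record row is discharged; YM₃ on T³ (route `UnitScaleTilt`) is rung R3 of the ladder — not the Clay problem,
not 𝕋⁴, not a mass gap; no summit or sub-problem statement is proved here.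

References: T. Bałaban, CMP 99 (1985) 389–434 [Balaban1985BackgroundPropagators] ((3.84)–(3.86) p.407); C. King, CMP 102 (1986) 649–677 [King1986] (Prop. 3.9 (3.73) p.665,
§4 pp.670–675); T. Bałaban, CMP 102 (1985) 255–275 [Balaban1985UV3] ((43)–(45) pp.266–267).
-/

set_option autoImplicit false

noncomputable section

open Filter Topology
open Literature.MathematicalPhysics.QuantumFieldTheory.Balaban1983to89.B9Eq386Neumann

namespace Summit.QuantumFields.YangMills.Theorems.TwoCutoffNeumannTransport

/-! ## §1 One ring: the resolvent identity and the Lipschitz bound of `gNew` in `(G, VG)` -/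
section OneRing
variable {A : Type*} [NormedRing A]
/-- The size letter of a geometric series is nonnegative: `0 ≤ ‖1‖ − 1 + (1 − ‖x‖)⁻¹` for `‖x‖ < 1` (it dominates `‖Σxⁿ‖ ≥ 0`). [folklore] -/
theorem geomBound_nonneg (x : A) (hx : ‖x‖ < 1) : 0 ≤ ‖(1 : A)‖ - 1 + (1 - ‖x‖)⁻¹ :=
  (norm_nonneg _).trans (tsum_geometric_le_of_norm_lt_one x hx)

/-- With `‖1‖ ≤ 1` (operators on a normed space) the size letter is MONOTONE and at most `(1 − t)⁻¹` for `‖x‖ ≤ t < 1`. [folklore] -/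
theorem geomBound_le_inv (x : A) {t : ℝ} (hxt : ‖x‖ ≤ t) (ht : t < 1) (h1 : ‖(1 : A)‖ ≤ 1) :
    ‖(1 : A)‖ - 1 + (1 - ‖x‖)⁻¹ ≤ (1 - t)⁻¹ := by
  have h : (1 - ‖x‖)⁻¹ ≤ (1 - t)⁻¹ := inv_anti₀ (by linarith) (by linarith)
  linarith

variable [HasSummableGeomSeries A]
/-- **Resolvent identity for geometric series**: `Σaⁿ − Σbⁿ = (Σaⁿ)·(a − b)·(Σbⁿ)` for `‖a‖, ‖b‖ < 1` — from `(Σaⁿ)(1 − a) = 1` and `(1 − b)(Σbⁿ) = 1`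
(`(1−a)⁻¹ − (1−b)⁻¹ = (1−a)⁻¹((1−b) − (1−a))(1−b)⁻¹`). [folklore] -/
theorem tsum_geometric_sub_tsum_geometric (a b : A) (ha : ‖a‖ < 1) (hb : ‖b‖ < 1) :
    ∑' n : ℕ, a ^ n - ∑' n : ℕ, b ^ n = (∑' n : ℕ, a ^ n) * (a - b) * ∑' n : ℕ, b ^ n := by
  have h1 : (∑' n : ℕ, a ^ n) * (1 - a) = 1 := geom_series_mul_neg a ha
  have h2 : (1 - b) * ∑' n : ℕ, b ^ n = 1 := mul_neg_geom_series b hb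
  have hab : a - b = (1 - b) - (1 - a) := by abel
  rw [hab, mul_sub, sub_mul, mul_assoc _ (1 - b), h2, mul_one, h1, one_mul]

/-- **The difference of two Neumann-series propagators, EXACTLY**: with `Sᵢ = Σ(VᵢGᵢ)ⁿ`,
`gNew G₁ V₁ − gNew G₂ V₂ = (G₁ − G₂)S₁ + G₂·S₁(V₁G₁ − V₂G₂)S₂` (second resolvent identity in the composite letter `VG`).
[folklore] [cite: Balaban1985BackgroundPropagators, (3.86) p.407] -/
theorem gNew_sub_gNew (G₁ V₁ G₂ V₂ : A) (h₁ : ‖V₁ * G₁‖ < 1) (h₂ : ‖V₂ * G₂‖ < 1) :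
    gNew G₁ V₁ - gNew G₂ V₂ =
      (G₁ - G₂) * (∑' n : ℕ, (V₁ * G₁) ^ n) +
        G₂ * ((∑' n : ℕ, (V₁ * G₁) ^ n) * (V₁ * G₁ - V₂ * G₂) * ∑' n : ℕ, (V₂ * G₂) ^ n) := by
  rw [← tsum_geometric_sub_tsum_geometric _ _ h₁ h₂, gNew, gNew]
  noncomm_ring

/-- **`gNew` IS LIPSCHITZ IN THE PAIR `(G, VG)`**: `‖gNew G₁ V₁ − gNew G₂ V₂‖ ≤ σ₁‖G₁ − G₂‖ + σ₁σ₂‖G₂‖·‖V₁G₁ − V₂G₂‖` with the size letters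
`σᵢ = ‖1‖ − 1 + (1 − ‖VᵢGᵢ‖)⁻¹` of `tsum_geometric_le_of_norm_lt_one`. [folklore] [cite: Balaban1985BackgroundPropagators, (3.86) p.407] -/
theorem norm_gNew_sub_gNew_le (G₁ V₁ G₂ V₂ : A) (h₁ : ‖V₁ * G₁‖ < 1) (h₂ : ‖V₂ * G₂‖ < 1) :
    ‖gNew G₁ V₁ - gNew G₂ V₂‖ ≤
      (‖(1 : A)‖ - 1 + (1 - ‖V₁ * G₁‖)⁻¹) * ‖G₁ - G₂‖ +
        (‖(1 : A)‖ - 1 + (1 - ‖V₁ * G₁‖)⁻¹) * (‖(1 : A)‖ - 1 + (1 - ‖V₂ * G₂‖)⁻¹) * ‖G₂‖ * ‖V₁ * G₁ - V₂ * G₂‖ := by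
  have hS₁ := tsum_geometric_le_of_norm_lt_one _ h₁
  have hS₂ := tsum_geometric_le_of_norm_lt_one _ h₂
  have hσ₁ := geomBound_nonneg _ h₁
  rw [gNew_sub_gNew G₁ V₁ G₂ V₂ h₁ h₂]
  refine (norm_add_le _ _).trans (add_le_add ?_ ?_)
  · calc ‖(G₁ - G₂) * ∑' n : ℕ, (V₁ * G₁) ^ n‖ ≤ ‖G₁ - G₂‖ * ‖∑' n : ℕ, (V₁ * G₁) ^ n‖ := norm_mul_le _ _
      _ ≤ ‖G₁ - G₂‖ * (‖(1 : A)‖ - 1 + (1 - ‖V₁ * G₁‖)⁻¹) := mul_le_mul_of_nonneg_left hS₁ (norm_nonneg _)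
      _ = (‖(1 : A)‖ - 1 + (1 - ‖V₁ * G₁‖)⁻¹) * ‖G₁ - G₂‖ := mul_comm _ _
  · calc ‖G₂ * ((∑' n : ℕ, (V₁ * G₁) ^ n) * (V₁ * G₁ - V₂ * G₂) * ∑' n : ℕ, (V₂ * G₂) ^ n)‖
        ≤ ‖G₂‖ * (‖∑' n : ℕ, (V₁ * G₁) ^ n‖ * ‖V₁ * G₁ - V₂ * G₂‖ * ‖∑' n : ℕ, (V₂ * G₂) ^ n‖) := by
          refine (norm_mul_le _ _).trans (mul_le_mul_of_nonneg_left ?_ (norm_nonneg _))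
          exact (norm_mul_le _ _).trans (mul_le_mul (norm_mul_le _ _) le_rfl (norm_nonneg _)
            (mul_nonneg (norm_nonneg _) (norm_nonneg _)))
      _ ≤ ‖G₂‖ * ((‖(1 : A)‖ - 1 + (1 - ‖V₁ * G₁‖)⁻¹) * ‖V₁ * G₁ - V₂ * G₂‖ * (‖(1 : A)‖ - 1 + (1 - ‖V₂ * G₂‖)⁻¹)) := by
          refine mul_le_mul_of_nonneg_left ?_ (norm_nonneg _)
          exact mul_le_mul (mul_le_mul_of_nonneg_right hS₁ (norm_nonneg _)) hS₂ (norm_nonneg _)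
            (mul_nonneg hσ₁ (norm_nonneg _))
      _ = (‖(1 : A)‖ - 1 + (1 - ‖V₁ * G₁‖)⁻¹) * (‖(1 : A)‖ - 1 + (1 - ‖V₂ * G₂‖)⁻¹) * ‖G₂‖ * ‖V₁ * G₁ - V₂ * G₂‖ := by ring

/-- The Lipschitz bound with ONE threshold `q`: `‖V₁G₁‖, ‖V₂G₂‖ ≤ q < 1` and `‖1‖ ≤ 1` give
`‖gNew G₁ V₁ − gNew G₂ V₂‖ ≤ ‖G₁ − G₂‖∕(1 − q) + ‖G₂‖·‖V₁G₁ − V₂G₂‖∕(1 − q)²`. [folklore] [cite: Balaban1985BackgroundPropagators, (3.86) p.407] -/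
theorem norm_gNew_sub_gNew_le_of_le (G₁ V₁ G₂ V₂ : A) {q : ℝ} (hq : q < 1) (h₁ : ‖V₁ * G₁‖ ≤ q) (h₂ : ‖V₂ * G₂‖ ≤ q)
    (h1 : ‖(1 : A)‖ ≤ 1) :
    ‖gNew G₁ V₁ - gNew G₂ V₂‖ ≤ ‖G₁ - G₂‖ / (1 - q) + ‖G₂‖ * ‖V₁ * G₁ - V₂ * G₂‖ / (1 - q) ^ 2 := by
  have h₁' : ‖V₁ * G₁‖ < 1 := lt_of_le_of_lt h₁ hq
  have h₂' : ‖V₂ * G₂‖ < 1 := lt_of_le_of_lt h₂ hq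
  have hb₁ := geomBound_le_inv _ h₁ hq h1
  have hb₂ := geomBound_le_inv _ h₂ hq h1
  have hσ₁ := geomBound_nonneg _ h₁'
  have hσ₂ := geomBound_nonneg _ h₂'
  have hq0 : 0 < 1 - q := by linarith
  refine (norm_gNew_sub_gNew_le G₁ V₁ G₂ V₂ h₁' h₂').trans ?_
  have e1 : ‖G₁ - G₂‖ / (1 - q) = (1 - q)⁻¹ * ‖G₁ - G₂‖ := by rw [div_eq_mul_inv, mul_comm]
  have e2 : ‖G₂‖ * ‖V₁ * G₁ - V₂ * G₂‖ / (1 - q) ^ 2 = (1 - q)⁻¹ * (1 - q)⁻¹ * ‖G₂‖ * ‖V₁ * G₁ - V₂ * G₂‖ := by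
    rw [div_eq_mul_inv, ← inv_pow]; ring
  rw [e1, e2]
  refine add_le_add (mul_le_mul_of_nonneg_right hb₁ (norm_nonneg _)) ?_
  have : (‖(1 : A)‖ - 1 + (1 - ‖V₁ * G₁‖)⁻¹) * (‖(1 : A)‖ - 1 + (1 - ‖V₂ * G₂‖)⁻¹) ≤ (1 - q)⁻¹ * (1 - q)⁻¹ :=
    mul_le_mul hb₁ hb₂ hσ₂ (inv_nonneg.mpr hq0.le)
  have hr : 0 ≤ ‖G₂‖ * ‖V₁ * G₁ - V₂ * G₂‖ := mul_nonneg (norm_nonneg _) (norm_nonneg _)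
  calc (‖(1 : A)‖ - 1 + (1 - ‖V₁ * G₁‖)⁻¹) * (‖(1 : A)‖ - 1 + (1 - ‖V₂ * G₂‖)⁻¹) * ‖G₂‖ * ‖V₁ * G₁ - V₂ * G₂‖
      = ((‖(1 : A)‖ - 1 + (1 - ‖V₁ * G₁‖)⁻¹) * (‖(1 : A)‖ - 1 + (1 - ‖V₂ * G₂‖)⁻¹)) * (‖G₂‖ * ‖V₁ * G₁ - V₂ * G₂‖) := by ring
    _ ≤ ((1 - q)⁻¹ * (1 - q)⁻¹) * (‖G₂‖ * ‖V₁ * G₁ - V₂ * G₂‖) := mul_le_mul_of_nonneg_right this hr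
    _ = (1 - q)⁻¹ * (1 - q)⁻¹ * ‖G₂‖ * ‖V₁ * G₁ - V₂ * G₂‖ := by ring
end OneRing

/-! ## §2 Two rings: a continuous additive multiplicative transport commutes with `gNew` -/
section Transport
variable {A B : Type*} [NormedRing A] [NormedRing B]
/-- A multiplicative additive map sends `G·(VG)ⁿ` to `φG·(φV·φG)ⁿ` — no unit is involved (`n = 0` reads `φ(G·1) = φG`). [folklore] -/
theorem map_mul_pow_eq (φ : A →+ B) (hmul : ∀ x y : A, φ (x * y) = φ x * φ y) (G V : A) (n : ℕ) :
    φ (G * (V * G) ^ n) = φ G * (φ V * φ G) ^ n := by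
  induction n with
  | zero => rw [pow_zero, pow_zero, mul_one, mul_one]
  | succ n ih => rw [pow_succ, ← mul_assoc, hmul, ih, hmul, pow_succ, mul_assoc]

variable [HasSummableGeomSeries A] [HasSummableGeomSeries B]
omit [HasSummableGeomSeries B] in
/-- The transported series converges to the transport of the sum: `HasSum (n ↦ φG(φV φG)ⁿ) (φ(gNew G V))` for a continuous additive multiplicative `φ` and
`‖VG‖ < 1`. [folklore] [cite: Balaban1985BackgroundPropagators, (3.86) p.407] -/
theorem hasSum_map_gNew (φ : A →+ B) (hmul : ∀ x y : A, φ (x * y) = φ x * φ y) (hφ : Continuous φ) (G V : A) (h : ‖V * G‖ < 1) :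
    HasSum (fun n : ℕ => φ G * (φ V * φ G) ^ n) (φ (gNew G V)) := by
  have hs := (hasSum_gNew G V h).map φ hφ
  have e : (φ ∘ fun n : ℕ => G * (V * G) ^ n) = fun n : ℕ => φ G * (φ V * φ G) ^ n := by
    funext n
    exact map_mul_pow_eq φ hmul G V n
  rwa [e] at hs

/-- **TRANSPORT COMMUTES WITH THE NEUMANN-SERIES PROPAGATOR**: for a continuous additive multiplicative `φ : A →+ B` (not necessarily unital — e.g. the conjugation
`X ↦ J X R` with `R J = 1` between the operator algebras of two lattices), `‖VG‖ < 1` and the transported COMPOSITE small, `‖φ(VG)‖ < 1`: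
`φ(G(I − VG)⁻¹) = (φG)(I − (φV)(φG))⁻¹`, i.e. `φ(gNew G V) = gNew (φG) (φV)`. [folklore] [cite: Balaban1985BackgroundPropagators, (3.86) p.407] -/
theorem map_gNew (φ : A →+ B) (hmul : ∀ x y : A, φ (x * y) = φ x * φ y) (hφ : Continuous φ) (G V : A)
    (h : ‖V * G‖ < 1) (h' : ‖φ (V * G)‖ < 1) :
    φ (gNew G V) = gNew (φ G) (φ V) :=
  (hasSum_map_gNew φ hmul hφ G V h).unique (hasSum_gNew (φ G) (φ V) (by rwa [hmul] at h'))
end Transport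

/-! ## §3 The two-cut-off row of the curved propagator from the flat row and the composite row -/
section TwoCutoff
variable {A B : Type*} [NormedRing A] [HasSummableGeomSeries A] [NormedRing B] [HasSummableGeomSeries B]
/-- **THE TWO-CUT-OFF ESTIMATE, size-letter form**: for a continuous additive multiplicative transport `φ`, run-1 letters `(G₁, V₁)` in `A` and run-2 letters `(G₂, V₂)`
in `B` with `‖V₁G₁‖ < 1`, `‖φ(V₁G₁)‖ < 1`, `‖V₂G₂‖ < 1`:
`‖φ(gNew G₁ V₁) − gNew G₂ V₂‖ ≤ σ₁′‖φG₁ − G₂‖ + σ₁′σ₂‖G₂‖·‖φ(V₁G₁) − V₂G₂‖`, `σ₁′ = ‖1‖ − 1 + (1 − ‖φ(V₁G₁)‖)⁻¹`, `σ₂ = ‖1‖ − 1 + (1 − ‖V₂G₂‖)⁻¹` —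
the curved two-cut-off row from the FLAT row `‖φG₁ − G₂‖` and the COMPOSITE row `‖φ(V₁G₁) − V₂G₂‖` (both binders).
[folklore] [cite: Balaban1985BackgroundPropagators, (3.84)-(3.86) p.407; King1986, Prop. 3.9 (3.73) p.665] -/
theorem norm_map_gNew_sub_gNew_le (φ : A →+ B) (hmul : ∀ x y : A, φ (x * y) = φ x * φ y) (hφ : Continuous φ)
    (G₁ V₁ : A) (G₂ V₂ : B) (h₁ : ‖V₁ * G₁‖ < 1) (h₁' : ‖φ (V₁ * G₁)‖ < 1) (h₂ : ‖V₂ * G₂‖ < 1) :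
    ‖φ (gNew G₁ V₁) - gNew G₂ V₂‖ ≤
      (‖(1 : B)‖ - 1 + (1 - ‖φ (V₁ * G₁)‖)⁻¹) * ‖φ G₁ - G₂‖ +
        (‖(1 : B)‖ - 1 + (1 - ‖φ (V₁ * G₁)‖)⁻¹) * (‖(1 : B)‖ - 1 + (1 - ‖V₂ * G₂‖)⁻¹) * ‖G₂‖ * ‖φ (V₁ * G₁) - V₂ * G₂‖ := by
  have hφVG : φ V₁ * φ G₁ = φ (V₁ * G₁) := (hmul V₁ G₁).symm
  have h₁'' : ‖φ V₁ * φ G₁‖ < 1 := by rwa [hφVG]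
  rw [map_gNew φ hmul hφ G₁ V₁ h₁ h₁']
  have := norm_gNew_sub_gNew_le (φ G₁) (φ V₁) G₂ V₂ h₁'' h₂
  rwa [hφVG] at this

/-- **THE TWO-CUT-OFF ESTIMATE, threshold form — smallness of the transported composite DERIVED**: if `‖V₁G₁‖ < 1` (run 1's own Neumann series converges),
`‖V₂G₂‖ ≤ q`, `‖φ(V₁G₁) − V₂G₂‖ ≤ ε`, `q + ε < 1`, `‖φG₁ − G₂‖ ≤ δ` and `‖1‖ ≤ 1` in `B`, then
`‖φ(gNew G₁ V₁) − gNew G₂ V₂‖ ≤ δ∕(1 − (q + ε)) + ‖G₂‖·ε∕(1 − (q + ε))²`.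
[folklore] [cite: Balaban1985BackgroundPropagators, (3.84)-(3.86) p.407; King1986, Prop. 3.9 (3.73) p.665] -/
theorem norm_map_gNew_sub_gNew_le_of_near (φ : A →+ B) (hmul : ∀ x y : A, φ (x * y) = φ x * φ y) (hφ : Continuous φ)
    (G₁ V₁ : A) (G₂ V₂ : B) {q ε δ : ℝ} (h₁ : ‖V₁ * G₁‖ < 1) (hq : ‖V₂ * G₂‖ ≤ q) (hε : ‖φ (V₁ * G₁) - V₂ * G₂‖ ≤ ε)
    (hqε : q + ε < 1) (hδ : ‖φ G₁ - G₂‖ ≤ δ) (h1 : ‖(1 : B)‖ ≤ 1) :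
    ‖φ (gNew G₁ V₁) - gNew G₂ V₂‖ ≤ δ / (1 - (q + ε)) + ‖G₂‖ * ε / (1 - (q + ε)) ^ 2 := by
  have hε0 : 0 ≤ ε := (norm_nonneg _).trans hε
  have hc : ‖φ (V₁ * G₁)‖ ≤ q + ε := by
    have := norm_le_insert' (φ (V₁ * G₁)) (V₂ * G₂)
    -- `‖a‖ ≤ ‖b‖ + ‖a - b‖`
    linarith [norm_sub_rev (φ (V₁ * G₁)) (V₂ * G₂)]
  have hq' : ‖V₂ * G₂‖ ≤ q + ε := hq.trans (by linarith)
  have hφVG : φ V₁ * φ G₁ = φ (V₁ * G₁) := (hmul V₁ G₁).symm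
  have h₁' : ‖φ (V₁ * G₁)‖ < 1 := lt_of_le_of_lt hc hqε
  rw [map_gNew φ hmul hφ G₁ V₁ h₁ h₁']
  have hmain := norm_gNew_sub_gNew_le_of_le (φ G₁) (φ V₁) G₂ V₂ hqε (by rwa [hφVG]) hq' h1
  rw [hφVG] at hmain
  refine hmain.trans (add_le_add ?_ ?_)
  · exact div_le_div_of_nonneg_right hδ (by linarith)
  · have hpos : 0 < (1 - (q + ε)) ^ 2 := by positivity
    exact div_le_div_of_nonneg_right (mul_le_mul_of_nonneg_left hε (norm_nonneg _)) hpos.le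
end TwoCutoff

/-! ## §4 The instance: conjugation by a prolongation ∕ restriction pair with `R ∘ J = id` -/
section Operators
variable {𝕜 E₁ E₂ : Type*} [NontriviallyNormedField 𝕜] [NormedAddCommGroup E₁] [NormedSpace 𝕜 E₁] [NormedAddCommGroup E₂] [NormedSpace 𝕜 E₂]
/-- **`R ∘ J = id` makes the conjugation MULTIPLICATIVE**: `J(XY)R = (JXR)(JYR)` (block average after block-constant prolongation is the identity, so the transported
product is the product of the transports). [folklore] -/
theorem conj_mul (J : E₁ →L[𝕜] E₂) (R : E₂ →L[𝕜] E₁) (hRJ : R.comp J = ContinuousLinearMap.id 𝕜 E₁) (X Y : E₁ →L[𝕜] E₁) :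
    J.comp ((X * Y).comp R) = J.comp (X.comp R) * J.comp (Y.comp R) := by
  have hRJ' : ∀ v : E₁, R (J v) = v := fun v => by
    simpa using congrArg (fun T : E₁ →L[𝕜] E₁ => T v) hRJ
  ext w
  simp only [mul_apply_eq_comp, ContinuousLinearMap.comp_apply, hRJ']

/-- The conjugation is bounded: `‖J X R‖ ≤ ‖J‖·‖R‖·‖X‖`. [folklore] -/
theorem norm_conj_le (J : E₁ →L[𝕜] E₂) (R : E₂ →L[𝕜] E₁) (X : E₁ →L[𝕜] E₁) :
    ‖J.comp (X.comp R)‖ ≤ ‖J‖ * ‖R‖ * ‖X‖ := by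
  calc ‖J.comp (X.comp R)‖ ≤ ‖J‖ * ‖X.comp R‖ := ContinuousLinearMap.opNorm_comp_le _ _
    _ ≤ ‖J‖ * (‖X‖ * ‖R‖) := mul_le_mul_of_nonneg_left (ContinuousLinearMap.opNorm_comp_le _ _) (norm_nonneg _)
    _ = ‖J‖ * ‖R‖ * ‖X‖ := by ring

variable [CompleteSpace E₁] [CompleteSpace E₂]
/-- **TRANSPORT OF (3.86) BETWEEN TWO LATTICES**: with `R ∘ J = id`, `‖VG‖ < 1` on run 1 and `‖J(VG)R‖ < 1` on run 2,
`J (G(I − VG)⁻¹) R = (JGR)(I − (JVR)(JGR))⁻¹`, i.e. `J (gNew G V) R = gNew (JGR) (JVR)`. [folklore] [cite: Balaban1985BackgroundPropagators, (3.86) p.407] -/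
theorem conj_gNew (J : E₁ →L[𝕜] E₂) (R : E₂ →L[𝕜] E₁) (hRJ : R.comp J = ContinuousLinearMap.id 𝕜 E₁) (G V : E₁ →L[𝕜] E₁)
    (h : ‖V * G‖ < 1) (h' : ‖J.comp ((V * G).comp R)‖ < 1) :
    J.comp ((gNew G V).comp R) = gNew (J.comp (G.comp R)) (J.comp (V.comp R)) :=
  map_gNew (AddMonoidHom.mk' (fun X : E₁ →L[𝕜] E₁ => J.comp (X.comp R)) fun X Y => by
      rw [ContinuousLinearMap.add_comp, ContinuousLinearMap.comp_add])
    (fun X Y => conj_mul J R hRJ X Y)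
    ((ContinuousLinearMap.compL 𝕜 E₂ E₁ E₂ J).continuous.comp ((ContinuousLinearMap.compL 𝕜 E₂ E₁ E₁).flip R).continuous) G V h h'

/-- **THE OPERATOR-LEVEL TWO-CUT-OFF ESTIMATE BY NAME**: prolongation `J`, restriction `R` with `R ∘ J = id`; run 1 letters `(G₁, V₁)` on `E₁`, run 2 letters
`(G₂, V₂)` on `E₂`; `‖V₁G₁‖ < 1`, `‖V₂G₂‖ ≤ q`, the COMPOSITE row `‖J(V₁G₁)R − V₂G₂‖ ≤ ε` with `q + ε < 1`, the FLAT row `‖JG₁R − G₂‖ ≤ δ` ⟹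
`‖J·G₁(I − V₁G₁)⁻¹·R − G₂(I − V₂G₂)⁻¹‖ ≤ δ∕(1 − (q+ε)) + ‖G₂‖·ε∕(1 − (q+ε))²`.
[folklore] [cite: Balaban1985BackgroundPropagators, (3.84)-(3.86) p.407; King1986, Prop. 3.9 (3.73) p.665] -/
theorem norm_conj_gNew_sub_gNew_le_of_near (J : E₁ →L[𝕜] E₂) (R : E₂ →L[𝕜] E₁) (hRJ : R.comp J = ContinuousLinearMap.id 𝕜 E₁)
    (G₁ V₁ : E₁ →L[𝕜] E₁) (G₂ V₂ : E₂ →L[𝕜] E₂) {q ε δ : ℝ} (h₁ : ‖V₁ * G₁‖ < 1) (hq : ‖V₂ * G₂‖ ≤ q)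
    (hε : ‖J.comp ((V₁ * G₁).comp R) - V₂ * G₂‖ ≤ ε) (hqε : q + ε < 1) (hδ : ‖J.comp (G₁.comp R) - G₂‖ ≤ δ) :
    ‖J.comp ((gNew G₁ V₁).comp R) - gNew G₂ V₂‖ ≤ δ / (1 - (q + ε)) + ‖G₂‖ * ε / (1 - (q + ε)) ^ 2 :=
  norm_map_gNew_sub_gNew_le_of_near (AddMonoidHom.mk' (fun X : E₁ →L[𝕜] E₁ => J.comp (X.comp R)) fun X Y => by
      rw [ContinuousLinearMap.add_comp, ContinuousLinearMap.comp_add])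
    (fun X Y => conj_mul J R hRJ X Y)
    ((ContinuousLinearMap.compL 𝕜 E₂ E₁ E₂ J).continuous.comp ((ContinuousLinearMap.compL 𝕜 E₂ E₁ E₁).flip R).continuous)
    G₁ V₁ G₂ V₂ h₁ hq hε hqε hδ ContinuousLinearMap.norm_id_le
end Operators

/-! ## §5 The sup-norm matrix instance and King's block pair (block mean `Q`, block-constant prolongation `N^d·Qᵀ`, `Q(N^dQᵀ) = 1`) -/
section SupNorm
open scoped Matrix.Norms.Operator
open Matrix

variable {m n : Type*} [Fintype m] [Fintype n]
/-- **Row sums bound the `ℓ^∞`-operator norm**: `(∀ i, Σ_j ‖A i j‖ ≤ C) ⟹ ‖A‖ ≤ C` (`C ≥ 0`) — the «supremum norm» of kernels in [B9] (3.85).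
[folklore] [cite: Balaban1985BackgroundPropagators, (3.85) p.407] -/
theorem linfty_opNorm_le_of_rows {α : Type*} [SeminormedAddCommGroup α] (A : Matrix m n α) {C : ℝ} (hC : 0 ≤ C)
    (h : ∀ i, ∑ j, ‖A i j‖ ≤ C) : ‖A‖ ≤ C := by
  rw [Matrix.linfty_opNorm_def, ← Real.coe_toNNReal C hC, NNReal.coe_le_coe]
  refine Finset.sup_le fun i _ => ?_
  rw [← NNReal.coe_le_coe, Real.coe_toNNReal _ hC]
  simp only [NNReal.coe_sum, coe_nnnorm]
  exact h i

/-- **Decaying kernels have bounded sup norm**: `‖A i j‖ ≤ c·w i j` entrywise and `Σ_j w i j ≤ V` for every row give `‖A‖ ≤ c·V` (King's «Σ_z exp[−δ₀|x − z|] ≤ C»).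
[folklore] [cite: King1986, (4.43) p.675] -/
theorem linfty_opNorm_le_of_decay {α : Type*} [SeminormedAddCommGroup α] (A : Matrix m n α) (w : m → n → ℝ) {c V : ℝ} (hc : 0 ≤ c)
    (hV : 0 ≤ V) (hA : ∀ i j, ‖A i j‖ ≤ c * w i j) (hw : ∀ i, ∑ j, w i j ≤ V) : ‖A‖ ≤ c * V := by
  refine linfty_opNorm_le_of_rows A (mul_nonneg hc hV) fun i => ?_
  calc ∑ j, ‖A i j‖ ≤ ∑ j, c * w i j := Finset.sum_le_sum fun j _ => hA i j
    _ = c * ∑ j, w i j := (Finset.mul_sum _ _ _).symm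
    _ ≤ c * V := mul_le_mul_of_nonneg_left (hw i) hc

/-- `‖1‖ ≤ 1` in the `ℓ^∞`-operator norm (also on the empty index type, where `‖1‖ = 0`). [folklore] -/
theorem linfty_opNorm_one_le {α : Type*} [SeminormedRing α] [NormOneClass α] [DecidableEq n] : ‖(1 : Matrix n n α)‖ ≤ 1 := by
  refine linfty_opNorm_le_of_rows (1 : Matrix n n α) zero_le_one fun i => ?_
  have : ∀ j, ‖(1 : Matrix n n α) i j‖ = if i = j then 1 else 0 := fun j => by
    rw [Matrix.one_apply]; split_ifs <;> simp
  simp_rw [this, Finset.sum_ite_eq, Finset.mem_univ, if_true, le_refl]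

variable [DecidableEq m] [DecidableEq n]
omit [DecidableEq n] in
/-- **`R J = 1` makes matrix conjugation multiplicative**: `J(XY)R = (JXR)(JYR)` for rectangular `J : n × m`, `R : m × n`. [folklore] -/
theorem matConj_mul {α : Type*} [Ring α] (J : Matrix n m α) (R : Matrix m n α) (hRJ : R * J = 1) (X Y : Matrix m m α) :
    J * (X * Y) * R = J * X * R * (J * Y * R) := by
  calc J * (X * Y) * R = J * (X * (R * J) * Y) * R := by rw [hRJ, Matrix.mul_one]
    _ = J * X * R * (J * Y * R) := by simp only [Matrix.mul_assoc]

/-- Matrix conjugation is bounded in the `ℓ^∞`-operator norm: `‖JXR‖ ≤ ‖J‖·‖R‖·‖X‖`. [folklore] -/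
theorem norm_matConj_le {α : Type*} [NormedRing α] (J : Matrix n m α) (R : Matrix m n α) (X : Matrix m m α) :
    ‖J * X * R‖ ≤ ‖J‖ * ‖R‖ * ‖X‖ := by
  calc ‖J * X * R‖ ≤ ‖J * X‖ * ‖R‖ := Matrix.linfty_opNorm_mul _ _
    _ ≤ ‖J‖ * ‖X‖ * ‖R‖ := mul_le_mul_of_nonneg_right (Matrix.linfty_opNorm_mul _ _) (norm_nonneg _)
    _ = ‖J‖ * ‖R‖ * ‖X‖ := by ring

/-- **THE TWO-CUT-OFF ESTIMATE IN THE SUP NORM OF KERNELS** (matrices over a complete normed ring, `ℓ^∞`-operator norm): `R J = 1`, `‖V₁G₁‖ < 1`, `‖V₂G₂‖ ≤ q`, the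
COMPOSITE row `‖J(V₁G₁)R − V₂G₂‖ ≤ ε`, `q + ε < 1`, the FLAT row `‖JG₁R − G₂‖ ≤ δ` ⟹
`‖J·G₁(I − V₁G₁)⁻¹·R − G₂(I − V₂G₂)⁻¹‖ ≤ δ∕(1 − (q+ε)) + ‖G₂‖·ε∕(1 − (q+ε))²`.
[folklore] [cite: Balaban1985BackgroundPropagators, (3.84)-(3.86) p.407; King1986, Prop. 3.9 (3.73) p.665] -/
theorem norm_matConj_gNew_sub_gNew_le_of_near {α : Type*} [NormedRing α] [NormOneClass α] [CompleteSpace α]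
    (J : Matrix n m α) (R : Matrix m n α) (hRJ : R * J = 1) (G₁ V₁ : Matrix m m α) (G₂ V₂ : Matrix n n α) {q ε δ : ℝ}
    (h₁ : ‖V₁ * G₁‖ < 1) (hq : ‖V₂ * G₂‖ ≤ q) (hε : ‖J * (V₁ * G₁) * R - V₂ * G₂‖ ≤ ε) (hqε : q + ε < 1) (hδ : ‖J * G₁ * R - G₂‖ ≤ δ) :
    ‖J * gNew G₁ V₁ * R - gNew G₂ V₂‖ ≤ δ / (1 - (q + ε)) + ‖G₂‖ * ε / (1 - (q + ε)) ^ 2 := by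
  -- the `ℓ^∞`-operator uniformity IS the product uniformity (Mathlib's `PiLp.seminormedAddCommGroupToPi` design), so completeness transfers
  haveI : @CompleteSpace (Matrix m m α) PseudoMetricSpace.toUniformSpace := (inferInstance : CompleteSpace (m → m → α))
  haveI : @CompleteSpace (Matrix n n α) PseudoMetricSpace.toUniformSpace := (inferInstance : CompleteSpace (n → n → α))
  have hφ : Continuous (AddMonoidHom.mk' (fun X : Matrix m m α => J * X * R) fun X Y => by rw [Matrix.mul_add, Matrix.add_mul]) :=
    (continuous_const.matrix_mul continuous_id).matrix_mul continuous_const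
  exact norm_map_gNew_sub_gNew_le_of_near (AddMonoidHom.mk' (fun X : Matrix m m α => J * X * R) fun X Y => by rw [Matrix.mul_add, Matrix.add_mul])
    (fun X Y => matConj_mul J R hRJ X Y) hφ G₁ V₁ G₂ V₂ h₁ hq hε hqε hδ linfty_opNorm_one_le
end SupNorm

/-! ### King's block pair: `R = Q` (block mean), `J = N^d·Qᵀ` (block-constant prolongation) -/
section BlockPair
open scoped Matrix.Norms.Operator
open Matrix
open Literature.MathematicalPhysics.QuantumFieldTheory.Balaban1983to89.B5Prop11Plancherel (Tor fine)
open Literature.MathematicalPhysics.QuantumFieldTheory.King1986.Torus (Qmat blockOf blockEquiv blockEquiv_apply blockOf_site Qmat_mul_transpose_Qmat)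

variable {d : ℕ} (N : ℕ) [NeZero N] (M : Fin d → ℕ) [∀ μ, NeZero (M μ)]
/-- **Block mean after block-constant prolongation is the identity**: `Q·(N^d Qᵀ) = 1` on the coarse torus (`Qmat_mul_transpose_Qmat`: `QQᵀ = N^{−d}·1`).
[cite: King1986, (2.4) p.652, (4.1) p.670] -/
theorem Qmat_mul_prolong : Qmat N M * (((N : ℝ) ^ d) • (Qmat N M)ᵀ) = 1 := by
  have hNd : ((N : ℝ) ^ d) ≠ 0 := pow_ne_zero _ (by exact_mod_cast NeZero.ne N)
  rw [Matrix.mul_smul, Qmat_mul_transpose_Qmat, smul_smul, mul_inv_cancel₀ hNd, one_smul]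

/-- The prolongation has exactly one entry `1` per row: `(N^d Qᵀ) z b = [blockOf z = b]`. [cite: King1986, (4.1) p.670] -/
theorem prolong_apply (z : Tor (fine N M)) (b : Tor M) :
    (((N : ℝ) ^ d) • (Qmat N M)ᵀ) z b = if blockOf N M z = b then 1 else 0 := by
  have hNd : ((N : ℝ) ^ d) ≠ 0 := pow_ne_zero _ (by exact_mod_cast NeZero.ne N)
  simp only [Matrix.smul_apply, Matrix.transpose_apply, Qmat, smul_eq_mul, mul_ite, mul_zero, mul_inv_cancel₀ hNd]

/-- **THE TRANSPORTED KERNEL IS THE BLOCK-CONSTANT EXTENSION WITH THE RIEMANN WEIGHT**: `((N^dQᵀ)·X·Q)(z, z′) = N^{−d}·X(⌊z∕N⌋, ⌊z′∕N⌋)` — King's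
«when x′ ∈ T_{η′}, we denote by x that point in T_η for which x′ ∈ B^n(x)» comparison currency. [cite: King1986, Prop. 3.8 p.664, (2.20) p.654] -/
theorem prolong_mul_mul_Qmat_apply (X : Matrix (Tor M) (Tor M) ℝ) (z z' : Tor (fine N M)) :
    ((((N : ℝ) ^ d) • (Qmat N M)ᵀ) * X * Qmat N M) z z' = (((N : ℝ) ^ d)⁻¹) * X (blockOf N M z) (blockOf N M z') := by
  have h1 : ∀ b', ((((N : ℝ) ^ d) • (Qmat N M)ᵀ) * X) z b' = X (blockOf N M z) b' := fun b' => by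
    rw [Matrix.mul_apply]
    simp_rw [prolong_apply, ite_mul, one_mul, zero_mul]
    rw [Finset.sum_ite_eq, if_pos (Finset.mem_univ _)]
  rw [Matrix.mul_apply]
  simp_rw [h1, Qmat, mul_ite, mul_zero]
  simp only [Finset.sum_ite_eq, Finset.mem_univ, if_true]
  rw [mul_comm]

/-- The block mean is a CONTRACTION in the sup norm: each row of `Q` has `N^d` entries `N^{−d}`, so `‖Q‖ ≤ 1`. [cite: King1986, (2.4) p.652] -/
theorem linfty_opNorm_Qmat_le_one : ‖Qmat N M‖ ≤ 1 := by
  have hNd : (0 : ℝ) < (N : ℝ) ^ d := pow_pos (by exact_mod_cast Nat.pos_of_ne_zero (NeZero.ne N)) _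
  refine linfty_opNorm_le_of_rows _ zero_le_one fun b => ?_
  have hrow : ∑ z, ‖Qmat N M b z‖ = ∑ z : Tor (fine N M), if blockOf N M z = b then ((N : ℝ) ^ d)⁻¹ else 0 := by
    refine Finset.sum_congr rfl fun z _ => ?_
    simp only [Qmat]; split_ifs <;> simp
  rw [hrow, ← (blockEquiv N M).sum_comp]
  simp only [Fintype.sum_prod_type, blockEquiv_apply, blockOf_site, Finset.sum_const, Finset.card_univ, smul_ite, smul_zero,
    Finset.sum_ite_eq', Finset.mem_univ, if_true, Fintype.card_fun, Fintype.card_fin, nsmul_eq_mul]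
  push_cast
  exact le_of_eq (mul_inv_cancel₀ hNd.ne')

/-- The block-constant prolongation is an ISOMETRY-type map in the sup norm: each row of `N^dQᵀ` has one entry `1`, so `‖N^dQᵀ‖ ≤ 1`. [cite: King1986, (4.1) p.670] -/
theorem linfty_opNorm_prolong_le_one : ‖((N : ℝ) ^ d) • (Qmat N M)ᵀ‖ ≤ 1 := by
  refine linfty_opNorm_le_of_rows _ zero_le_one fun z => ?_
  have : ∀ b, ‖(((N : ℝ) ^ d) • (Qmat N M)ᵀ) z b‖ = if blockOf N M z = b then 1 else 0 := fun b => by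
    rw [prolong_apply]; split_ifs <;> simp
  simp_rw [this, Finset.sum_ite_eq, Finset.mem_univ, if_true, le_refl]

/-- Hence the block transport is a contraction: `‖(N^dQᵀ)·X·Q‖ ≤ ‖X‖`. [cite: King1986, (2.20) p.654] -/
theorem norm_blockConj_le (X : Matrix (Tor M) (Tor M) ℝ) : ‖(((N : ℝ) ^ d) • (Qmat N M)ᵀ) * X * Qmat N M‖ ≤ ‖X‖ := by
  refine (norm_matConj_le _ _ X).trans ?_
  have h := mul_le_mul (linfty_opNorm_prolong_le_one N M) (linfty_opNorm_Qmat_le_one N M) (norm_nonneg _) zero_le_one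
  calc ‖((N : ℝ) ^ d) • (Qmat N M)ᵀ‖ * ‖Qmat N M‖ * ‖X‖ ≤ 1 * 1 * ‖X‖ := mul_le_mul_of_nonneg_right h (norm_nonneg _)
    _ = ‖X‖ := by ring

/-- **THE TWO-CUT-OFF NEUMANN ESTIMATE FOR KING'S BLOCK PAIR, BY NAME**: coarse-lattice letters `(G₁, V₁)` on `Tor M`, fine-lattice letters `(G₂, V₂)` on `Tor (fine N M)`
(any `N`, any torus — for two UV cut-offs take `M :=` the coarser run's fine torus and `N := Lⁿ`), `‖V₁G₁‖ < 1`, `‖V₂G₂‖ ≤ q`, the composite row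
`‖(N^dQᵀ)(V₁G₁)Q − V₂G₂‖ ≤ ε`, `q + ε < 1`, the flat row `‖(N^dQᵀ)G₁Q − G₂‖ ≤ δ` ⟹ `‖(N^dQᵀ)·gNew G₁ V₁·Q − gNew G₂ V₂‖ ≤ δ∕(1 − (q+ε)) + ‖G₂‖·ε∕(1 − (q+ε))²`,
all norms the sup norm of kernels. [folklore] [cite: Balaban1985BackgroundPropagators, (3.84)-(3.86) p.407; King1986, Prop. 3.9 (3.73) p.665] -/
theorem norm_blockConj_gNew_sub_gNew_le_of_near (G₁ V₁ : Matrix (Tor M) (Tor M) ℝ) (G₂ V₂ : Matrix (Tor (fine N M)) (Tor (fine N M)) ℝ) {q ε δ : ℝ}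
    (h₁ : ‖V₁ * G₁‖ < 1) (hq : ‖V₂ * G₂‖ ≤ q) (hε : ‖(((N : ℝ) ^ d) • (Qmat N M)ᵀ) * (V₁ * G₁) * Qmat N M - V₂ * G₂‖ ≤ ε) (hqε : q + ε < 1)
    (hδ : ‖(((N : ℝ) ^ d) • (Qmat N M)ᵀ) * G₁ * Qmat N M - G₂‖ ≤ δ) :
    ‖(((N : ℝ) ^ d) • (Qmat N M)ᵀ) * gNew G₁ V₁ * Qmat N M - gNew G₂ V₂‖ ≤ δ / (1 - (q + ε)) + ‖G₂‖ * ε / (1 - (q + ε)) ^ 2 :=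
  norm_matConj_gNew_sub_gNew_le_of_near _ _ (Qmat_mul_prolong N M) G₁ V₁ G₂ V₂ h₁ hq hε hqε hδ
end BlockPair
end Summit.QuantumFields.YangMills.Theorems.TwoCutoffNeumannTransport

end
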